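import Mathlib
import Summits.QuantumFields.YangMills.Theorems.BalabanUVNodesN15BackgroundGaugeSpeciesMatrix
import Summits.QuantumFields.YangMills.Theorems.BalabanUVNodesN15BackgroundLayerFirstOrderMatrixFull
import HarnessLib

/-!
# Route «BalabanUVNodes» (cluster K4 «SpineRates»), Track-A DAG node N15 = spine estimate NE2, BACKGROUND LAYER — `T4EtaRate.NE2PlusOperator` BY NAME WITH
# THE NON-ABELIAN GAUGE FIELD LIVE: the four (3.42) entries of the background-dependent pair whose first-order perturbation has MATRIX coefficients DERIVED
# from the configuration `A′ : J → X′ → 𝔄` through the print's species `Phi1(η, ad_A)` in coordinates, under the guard, per index with explicit constants,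
# and for any family

Cell `pub-ymgap`, seat `pub-ymgap-dag-n15-c` (generation g2; R134 ACCELERATION SEAT, strategy s1 — g0's located successor object (N1′) «C1∕C2-MATRIX SPECIES»;
HUMAN RULING D-0062; chair R424 venue).  `bears_on: R4∕N15`.  Filed `--supports stmt-QuantumFields-19676` (K3; helper).  Imports BY NAME, nothing in the tree
modified: this seat's G1 `…N15BackgroundGaugeSpeciesMatrix` (`gaugeBgM`, `gcoefM`, `gacoefM`, `gavgM`, `gaugeInstanceM`, `gaugeM_letters_of_reg335`) and M3
`…N15BackgroundLayerFirstOrderMatrixFull` (through it M1 `bgPairM`∕`unstackM`, n15-b's B1a∕B1b∕B3 `hasMaj_idef_bgPropV`∕`bgSourceV`∕`bgDerivedV`, `hasMaj_stack`,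
`idef_stack`, `hasMaj_projO_comp`, `poly0_le`, `bgConst`, `bgConst1`, g0's `opFamily`, `etaRateIneq342_of_hasMaj`).

THE POINT.  n15-b's C2 `…N15BackgroundGaugeByName` = `NE2PlusOperator` by name with an ABELIAN scalar gauge field live; this seat's M1–M3 = the same for
ABSTRACT matrix coefficient families.  Here the two meet (C2 for the print's matrix species, [Balaban1985BackgroundPropagators] (3.50)–(3.52) p. 400): the
configuration is the `𝔄`-valued GAUGE FIELD `A′` (`𝔄 ≅ ℝ^ι`, `ad` = commutator, coordinates `e`), regular in the sense of the (3.35) letter pair IN THE NORM OF `𝔄`;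
the perturbation `V′ = D_{U′} − ∇′` has MATRIX coefficients DERIVED from it (G1 `gcoefM`∕`gacoefM`), the coarse run's from the fibrewise-averaged field; M1's
non-abelian pair `bgPairM` and ALL FOUR (3.42) entry operators of its η-difference are bounded under the printed guard `M ≥ M₅`, `M·α₀ ≤ a₀` with the letters read off
`Reg335` — `NE2PlusOperator` BY NAME with the NON-ABELIAN `U` LIVE, the ONLY displayed hypotheses being the NE2⁰ operator layer of the `U ≡ 1` pieces on the
product carrier (inhabited at the vector piece ⊗ 1_𝔤 in the sequel `…VectorPieceGaugeMatrix`).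

CONTENTS ([folklore] bookkeeping; 3 defs).
* §1 `gMc35 J κ c₃₅ = 8e(1+|J|)²(1+κ)c₃₅` (the effective (3.35) constant of the derived matrix coefficients, `κ = κ_e`), `le_gMc35`; **`hasMaj_gaugeM_entries`** — per
  index, per regular `A′`: the four entry defects `≤ K·θ·e^{−(δ−σ)d}` with `K ∈ {bgConst, bgConst1}(β, c_r, m₀, gMc35, a₀)` under `M ≥ 1`, `α₀ > 0`, `M·α₀ ≤ a₀`,
  `2c₃₅a₀ ≤ 1`, `β·(gMc35·a₀)·c_r ≤ ½`, spacings `η′ ≤ η ≤ min(1, θ)`.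
* §2 `gaugeOpsM4`, `gaugeFamilyM4`; **`etaRateIneq342_gaugeM`** (per index, `B₀ = bgConst + bgConst1`, `δ₀ = δ − σ`); **`ne2PlusOperator_gaugeM`** (any family;
  `M₅ := 1`, `a₀ := (2·gMc35·(βc_r + 1))⁻¹`).

HONEST FRAMING ∕ LIMITS.  `𝔤` MODELLED by a complete normed algebra with `ad` = the commutator and a coordinate system (parts 13a–c∕16); one `Phi1` per direction
(no `F′_{1,k}` second-order term); the `U ≡ 1` layer on the product carrier (pieces `G, ∇_μG, G∇*, ∇_μG∇*, ΔG` at both spacings and their η-defects with rate number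
`θ ≥ η`) DISPLAYED; linearised (fibrewise-mean) transport of the gauge field — NOT the (C3) nonlinear average; sites of size `≥ 1`; the guard reads the datum's
`M`; crude constants; nothing about Bałaban's `G(U)` of [B6]∕[B9] asserted.  NE2⁺ NOT PRINTED, NOT proved; count-neutral (typed 28∕28; nothing discharged); N15 NOT
discharged; one finite lattice at fixed ε — NOT infinite volume, NOT OS on ℝ⁴, NOT a mass gap, NOT Clay.
-/

noncomputable section

namespace Summit.QuantumFields.YangMills.BalabanUVNodes.N15.BackgroundLayer

open Literature.MathematicalPhysics.QuantumFieldTheory.Balaban1983to89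
open Literature.MathematicalPhysics.QuantumFieldTheory.Balaban1983to89.B11SectG (BlockNorm HasMaj RowSum)
open Literature.MathematicalPhysics.QuantumFieldTheory.Balaban1983to89.T4EtaRate (PairedInstance EtaRateIneq342 NE2PlusOperator rateFactor)
open Literature.MathematicalPhysics.QuantumFieldTheory.Balaban1983to89.T4EtaRateDefect (idef rateWeight)
open Literature.MathematicalPhysics.QuantumFieldTheory.Balaban1983to89.T4EtaRateCoeffDefect (pull)
open Literature.MathematicalPhysics.QuantumFieldTheory.Balaban1983to89.B6RandomWalk (Triangle254)
open Literature.MathematicalPhysics.QuantumFieldTheory.Balaban1983to89.B9SectDSup (inv_one_sub_le_two)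
open Summit.QuantumFields.YangMills.BalabanUVNodes.N15.OperatorReadout (opGeo opFamily opGeo_len rateFactor_opGeo etaRateIneq342_of_hasMaj)
open Summit.QuantumFields.YangMills.BalabanUVNodes.N15.MatrixSpecies (liftMap liftBlk basisConst basisConst_nonneg)

/-! ## §1 The four entries of the non-abelian gauge-species pair under the guard -/

section Guard

variable {X X' J ι : Type} [Fintype X] [Fintype X'] [Fintype J] [Fintype ι] [DecidableEq X] [DecidableEq X'] [DecidableEq J] [DecidableEq ι]
  {𝔄 : Type} [NormedRing 𝔄] [NormedAlgebra ℝ 𝔄] [CompleteSpace 𝔄] (e : 𝔄 ≃L[ℝ] (ι → ℝ)) {g : B6.Geometry} (blk : X → g.Site) (π : X' → X)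

/-- THE EFFECTIVE (3.35) CONSTANT of the derived matrix coefficients: `8e(1 + |J|)²(1 + κ)·c₃₅` (so the stacked max-row-sum letter `r₁(1+|J|)` of G1 is
`≤ gMc35·a₀` under the guard; `κ = κ_e` the basis constant). [folklore] -/
def gMc35 (J : Type) [Fintype J] (κ c35 : ℝ) : ℝ := 8 * Real.exp 1 * (1 + Fintype.card J) * (1 + Fintype.card J) * (1 + κ) * c35

omit [Fintype X] [Fintype X'] [DecidableEq X] [DecidableEq X'] [DecidableEq J] in
/-- `c₃₅ ≤ gMc35` and `0 < gMc35` for `c₃₅ > 0`, `κ ≥ 0`. [folklore] -/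
theorem le_gMc35 {κ c35 : ℝ} (hκ : 0 ≤ κ) (hc35 : 0 < c35) : c35 ≤ gMc35 J κ c35 ∧ 0 < gMc35 J κ c35 := by
  have he : (1 : ℝ) ≤ 8 * Real.exp 1 := by have := Real.add_one_le_exp (1 : ℝ); linarith
  have hJ : (1 : ℝ) ≤ 1 + Fintype.card J := le_add_of_nonneg_right (Nat.cast_nonneg _)
  have hk : (1 : ℝ) ≤ 1 + κ := le_add_of_nonneg_right hκ
  have h1 : (1 : ℝ) ≤ 8 * Real.exp 1 * (1 + Fintype.card J) * (1 + Fintype.card J) * (1 + κ) := by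
    have h2 := one_le_mul_of_one_le_of_one_le he hJ
    have h3 := one_le_mul_of_one_le_of_one_le h2 hJ
    exact one_le_mul_of_one_le_of_one_le h3 hk
  unfold gMc35
  constructor
  · nlinarith
  · positivity

variable {G S D₃ : (X × ι → ℝ) →ₗ[ℝ] (X × ι → ℝ)} {D SD : J → (X × ι → ℝ) →ₗ[ℝ] (X × ι → ℝ)} {G' S' D₃' : (X' × ι → ℝ) →ₗ[ℝ] (X' × ι → ℝ)}
  {D' SD' : J → (X' × ι → ℝ) →ₗ[ℝ] (X' × ι → ℝ)}

/-- **THE FOUR ENTRY DEFECTS OF THE NON-ABELIAN GAUGE-SPECIES PAIR UNDER THE GUARD.**  `U ≡ 1` layer on the product carrier `X × ι`: `G, D_μ, S, SD_μ` (coarse) and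
`G′, D′_μ, D₃′` (fine) `≤ β·e^{−δd}`, the five η-defects `≤ m₀·θ·e^{−δd}`, `σ ≤ δ`; spacings `0 ≤ η′ ≤ η ≤ 1`, `η ≤ θ`; guard `c₃₅ > 0`, `a₀ ≥ 0`, `2c₃₅a₀ ≤ 1` (the `ad`
regime), `β·(gMc35·a₀)·c_r ≤ ½`, `M ≥ 1`, `α₀ > 0`, `M·α₀ ≤ a₀`; gauge field `A′ : J → X′ → 𝔄` with `(gaugeBgM 𝔄 J π M θ).Reg335 c₃₅ α₀ A′`.  With the DERIVED matrix
coefficients `C′ = gcoefM e η′ A′`, `A′coef = gacoefM e η′ A′`, `C̄ = gcoefM e η Ā`, `Ācoef = gacoefM e η Ā`, `Ā = gavgM A′`: entries 0∕1 (components `j` of M1's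
`bgPairM`), entry 2 (source step over the stacks, source stack `(S, SD_μ)`), entry 3 (derived object of `D₃`) have majorants `K·θ·e^{−(δ−σ)d}`, `K = bgConst` (entries
0∕1∕2), `bgConst1` (entry 3) at `(β, c_r, m₀, gMc35, a₀)`. [cite: Balaban1985BackgroundPropagators, Thm 3.1 (3.42) p.397 (quantifier template, entries: shapes); (3.35) p.396, (3.50)–(3.52) p.400, (3.63)–(3.65) pp.402–403 (shapes, mechanism)] -/
theorem hasMaj_gaugeM_entries (htri : Triangle254 g) (hd : ∀ a b : g.Site, 0 ≤ g.dist a b) {σ cr : ℝ} (hσ : 0 ≤ σ) (hcr : 0 ≤ cr) (hrow : RowSum g σ cr)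
    {δ β m₀ θ c35 a₀ M α₀ η η' : ℝ} (hσδ : σ ≤ δ) (hβ : 0 ≤ β) (hm₀ : 0 ≤ m₀) (hθ : 0 ≤ θ) (hc35 : 0 < c35) (ha₀ : 0 ≤ a₀) (ha₀1 : 2 * (c35 * a₀) ≤ 1)
    (hq : β * (gMc35 J (basisConst e) c35 * a₀) * cr ≤ 1 / 2) (hM : 1 ≤ M) (hα₀ : 0 < α₀) (hMα : M * α₀ ≤ a₀)
    (hη' : 0 ≤ η') (hη'η : η' ≤ η) (hη1 : η ≤ 1) (hηθ : η ≤ θ)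
    (hG : HasMaj (BlockNorm.ofBlocks g (liftBlk blk ι)) (BlockNorm.ofBlocks g (liftBlk blk ι)) G (fun y y' => β * Real.exp (-(δ * g.dist y y'))))
    (hD : ∀ μ, HasMaj (BlockNorm.ofBlocks g (liftBlk blk ι)) (BlockNorm.ofBlocks g (liftBlk blk ι)) (D μ) (fun y y' => β * Real.exp (-(δ * g.dist y y'))))
    (hG' : HasMaj (BlockNorm.ofBlocks g (liftBlk (blk ∘ π) ι)) (BlockNorm.ofBlocks g (liftBlk (blk ∘ π) ι)) G' (fun y y' => β * Real.exp (-(δ * g.dist y y'))))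
    (hD' : ∀ μ, HasMaj (BlockNorm.ofBlocks g (liftBlk (blk ∘ π) ι)) (BlockNorm.ofBlocks g (liftBlk (blk ∘ π) ι)) (D' μ) (fun y y' => β * Real.exp (-(δ * g.dist y y'))))
    (hS : HasMaj (BlockNorm.ofBlocks g (liftBlk blk ι)) (BlockNorm.ofBlocks g (liftBlk blk ι)) S (fun y y' => β * Real.exp (-(δ * g.dist y y'))))
    (hSD : ∀ μ, HasMaj (BlockNorm.ofBlocks g (liftBlk blk ι)) (BlockNorm.ofBlocks g (liftBlk blk ι)) (SD μ) (fun y y' => β * Real.exp (-(δ * g.dist y y'))))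
    (hD₃' : HasMaj (BlockNorm.ofBlocks g (liftBlk (blk ∘ π) ι)) (BlockNorm.ofBlocks g (liftBlk (blk ∘ π) ι)) D₃' (fun y y' => β * Real.exp (-(δ * g.dist y y'))))
    (hDG : HasMaj (BlockNorm.ofBlocks g (liftBlk blk ι)) (BlockNorm.ofBlocks g (liftBlk (blk ∘ π) ι))
      (idef (pull (liftMap π ι)) (pull (liftMap π ι)) G' G) (fun y y' => m₀ * θ * Real.exp (-(δ * g.dist y y'))))
    (hDD : ∀ μ, HasMaj (BlockNorm.ofBlocks g (liftBlk blk ι)) (BlockNorm.ofBlocks g (liftBlk (blk ∘ π) ι))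
      (idef (pull (liftMap π ι)) (pull (liftMap π ι)) (D' μ) (D μ)) (fun y y' => m₀ * θ * Real.exp (-(δ * g.dist y y'))))
    (hDS : HasMaj (BlockNorm.ofBlocks g (liftBlk blk ι)) (BlockNorm.ofBlocks g (liftBlk (blk ∘ π) ι))
      (idef (pull (liftMap π ι)) (pull (liftMap π ι)) S' S) (fun y y' => m₀ * θ * Real.exp (-(δ * g.dist y y'))))
    (hDSD : ∀ μ, HasMaj (BlockNorm.ofBlocks g (liftBlk blk ι)) (BlockNorm.ofBlocks g (liftBlk (blk ∘ π) ι))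
      (idef (pull (liftMap π ι)) (pull (liftMap π ι)) (SD' μ) (SD μ)) (fun y y' => m₀ * θ * Real.exp (-(δ * g.dist y y'))))
    (hDD₃ : HasMaj (BlockNorm.ofBlocks g (liftBlk blk ι)) (BlockNorm.ofBlocks g (liftBlk (blk ∘ π) ι))
      (idef (pull (liftMap π ι)) (pull (liftMap π ι)) D₃' D₃) (fun y y' => m₀ * θ * Real.exp (-(δ * g.dist y y'))))
    {A' : J → X' → 𝔄} (hreg : (gaugeBgM 𝔄 J π M θ).Reg335 c35 α₀ A') :
    (∀ j : Option J, HasMaj (BlockNorm.ofBlocks g (liftBlk blk ι)) (BlockNorm.ofBlocks g (liftBlk (blk ∘ π) ι))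
      (idef (pull (liftMap π ι)) (pull (liftMap π ι)) (projO j ∘ₗ bgPairM G' D' (gcoefM e η' A') (gacoefM e η' A'))
        (projO j ∘ₗ bgPairM G D (gcoefM e η (gavgM 𝔄 J π A')) (gacoefM e η (gavgM 𝔄 J π A'))))
      (fun y y' => bgConst β cr m₀ (gMc35 J (basisConst e) c35) a₀ * θ * Real.exp (-((δ - σ) * g.dist y y')))) ∧
    HasMaj (BlockNorm.ofBlocks g (liftBlk blk ι)) (BlockNorm.ofBlocks g (liftBlk (blk ∘ π) ι))
      (idef (pull (liftMap π ι)) (pull (liftMap π ι))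
        (projO none ∘ₗ bgSourceV (stack G' D') (stack S' SD') (unstackM (gcoefM e η' A') (gacoefM e η' A')))
        (projO none ∘ₗ bgSourceV (stack G D) (stack S SD) (unstackM (gcoefM e η (gavgM 𝔄 J π A')) (gacoefM e η (gavgM 𝔄 J π A')))))
      (fun y y' => bgConst β cr m₀ (gMc35 J (basisConst e) c35) a₀ * θ * Real.exp (-((δ - σ) * g.dist y y'))) ∧
    HasMaj (BlockNorm.ofBlocks g (liftBlk blk ι)) (BlockNorm.ofBlocks g (liftBlk (blk ∘ π) ι))
      (idef (pull (liftMap π ι)) (pull (liftMap π ι)) (bgDerivedV (stack G' D') D₃' (unstackM (gcoefM e η' A') (gacoefM e η' A')))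
        (bgDerivedV (stack G D) D₃ (unstackM (gcoefM e η (gavgM 𝔄 J π A')) (gacoefM e η (gavgM 𝔄 J π A')))))
      (fun y y' => bgConst1 β cr m₀ (gMc35 J (basisConst e) c35) a₀ * θ * Real.exp (-((δ - σ) * g.dist y y'))) := by
  obtain ⟨hr₁0, hr₁a, hV, hV', hDV⟩ := gaugeM_letters_of_reg335 e (g := g) blk π hη' hη'η hη1 hηθ hc35 hM hα₀ hMα ha₀1 hreg
  set R : ℝ := 8 * Real.exp 1 * (1 + Fintype.card J) * basisConst e * (c35 * M * α₀) * (1 + Fintype.card J) with hR_def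
  have hJ0 : (0 : ℝ) ≤ 1 + Fintype.card J := by positivity
  have hR0 : 0 ≤ R := mul_nonneg hr₁0 hJ0
  have hκ : 0 ≤ basisConst e := basisConst_nonneg e
  have hca : 0 ≤ c35 * a₀ := mul_nonneg hc35.le ha₀
  have hRa : R ≤ gMc35 J (basisConst e) c35 * a₀ := by
    calc R ≤ 8 * Real.exp 1 * (1 + Fintype.card J) * basisConst e * c35 * a₀ * (1 + Fintype.card J) := mul_le_mul_of_nonneg_right hr₁a hJ0
      _ = (8 * Real.exp 1 * (1 + Fintype.card J) * (1 + Fintype.card J) * (c35 * a₀)) * basisConst e := by ring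
      _ ≤ (8 * Real.exp 1 * (1 + Fintype.card J) * (1 + Fintype.card J) * (c35 * a₀)) * (1 + basisConst e) :=
          mul_le_mul_of_nonneg_left (by linarith) (by positivity)
      _ = gMc35 J (basisConst e) c35 * a₀ := by unfold gMc35; ring
  have hq' : β * R * cr ≤ 1 / 2 := (mul_le_mul_of_nonneg_right (mul_le_mul_of_nonneg_left hRa hβ) hcr).trans hq
  have hq1 : β * R * cr < 1 := by linarith
  have hinv : (1 - β * R * cr)⁻¹ ≤ 2 := inv_one_sub_le_two hq'
  have hinv0 : 0 ≤ (1 - β * R * cr)⁻¹ := inv_nonneg.2 (by linarith)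
  have hRθ : 8 * Real.exp 1 * (1 + Fintype.card J) * basisConst e * (c35 * M * α₀) * θ * (1 + Fintype.card J) = R * θ := by rw [hR_def]; ring
  rw [hRθ] at hDV
  have hβe : ∀ y y' : g.Site, 0 ≤ β * Real.exp (-(δ * g.dist y y')) := fun _ _ => mul_nonneg hβ (Real.exp_nonneg _)
  have hme : ∀ y y' : g.Site, 0 ≤ m₀ * θ * Real.exp (-(δ * g.dist y y')) := fun _ _ => mul_nonneg (mul_nonneg hm₀ hθ) (Real.exp_nonneg _)
  have hSG := hasMaj_stack (liftBlk blk ι) hβe hG hD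
  have hSG' := hasMaj_stack (liftBlk (blk ∘ π) ι) hβe hG' hD'
  have hSS := hasMaj_stack (liftBlk blk ι) hβe hS hSD
  have hSDG : HasMaj (BlockNorm.ofBlocks g (liftBlk blk ι)) (BlockNorm.ofBlocks g (blkPair (liftBlk (blk ∘ π) ι)))
      (idef (pull (liftMap π ι)) (pull (liftPair (liftMap π ι))) (stack G' D') (stack G D)) (fun y y' => m₀ * θ * Real.exp (-(δ * g.dist y y'))) := by
    rw [idef_stack]; exact hasMaj_stack (liftBlk (blk ∘ π) ι) hme hDG hDD
  have hSDS : HasMaj (BlockNorm.ofBlocks g (liftBlk blk ι)) (BlockNorm.ofBlocks g (blkPair (liftBlk (blk ∘ π) ι)))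
      (idef (pull (liftMap π ι)) (pull (liftPair (liftMap π ι))) (stack S' SD') (stack S SD)) (fun y y' => m₀ * θ * Real.exp (-(δ * g.dist y y'))) := by
    rw [idef_stack]; exact hasMaj_stack (liftBlk (blk ∘ π) ι) hme hDS hDSD
  have hRθ0 : 0 ≤ R * θ := mul_nonneg hR0 hθ
  set u : ℝ := (1 - β * R * cr)⁻¹ with hu_def
  have h0 := poly0_le (β := β) (cr := cr) (m₀ := m₀) (θ := θ) (c35 := gMc35 J (basisConst e) c35) (a₀ := a₀) (r := R) (u := u) hβ hcr hm₀ hθ hR0 hRa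
    hinv0 hinv
  have hE : ∀ a b : g.Site, 0 ≤ Real.exp (-((δ - σ) * g.dist a b)) := fun _ _ => Real.exp_nonneg _
  refine ⟨fun j => ?_, ?_, ?_⟩
  · -- entries 0∕1: B1a on the stacked pair over the product carrier, then the component
    have key := hasMaj_idef_bgPropV (liftBlk blk ι) (blkPair (liftBlk blk ι)) (liftMap π ι) (liftPair (liftMap π ι)) htri hd hσ hcr hrow (ρ := δ - σ)
      (by linarith) (by linarith) hβ hR0 hRθ0 (mul_nonneg hm₀ hθ) hSG hSG' hSDG hV hV' hDV hq1
    have keyj := hasMaj_projO_comp (liftBlk (blk ∘ π) ι) key j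
    have hcomp : idef (pull (liftMap π ι)) (pull (liftMap π ι)) (projO j ∘ₗ bgPairM G' D' (gcoefM e η' A') (gacoefM e η' A'))
        (projO j ∘ₗ bgPairM G D (gcoefM e η (gavgM 𝔄 J π A')) (gacoefM e η (gavgM 𝔄 J π A'))) =
        projO j ∘ₗ idef (pull (liftMap π ι)) (pull (liftPair (liftMap π ι)))
          (bgPropV (stack G' D') (unstackM (gcoefM e η' A') (gacoefM e η' A')))
          (bgPropV (stack G D) (unstackM (gcoefM e η (gavgM 𝔄 J π A')) (gacoefM e η (gavgM 𝔄 J π A')))) :=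
      LinearMap.ext fun v => funext fun x' => rfl
    rw [hcomp]
    refine keyj.mono fun a b => ?_
    simp only [one_mul]
    exact mul_le_mul_of_nonneg_right h0 (hE a b)
  · -- entry 2: the source step over the stacks, `none` component
    have key := hasMaj_idef_bgSourceV (liftBlk blk ι) (blkPair (liftBlk blk ι)) (liftMap π ι) (liftPair (liftMap π ι)) htri hd hσ hcr hrow (ρ := δ - σ)
      (by linarith) (by linarith) hβ hR0 hRθ0 (mul_nonneg hm₀ hθ) (mul_nonneg hm₀ hθ) hSG hSG' hSS hSDG hSDS hV hV' hDV hq1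
    have keyj := hasMaj_projO_comp (liftBlk (blk ∘ π) ι) key none
    have hcomp : idef (pull (liftMap π ι)) (pull (liftMap π ι))
        (projO none ∘ₗ bgSourceV (stack G' D') (stack S' SD') (unstackM (gcoefM e η' A') (gacoefM e η' A')))
        (projO none ∘ₗ bgSourceV (stack G D) (stack S SD) (unstackM (gcoefM e η (gavgM 𝔄 J π A')) (gacoefM e η (gavgM 𝔄 J π A')))) =
        projO none ∘ₗ idef (pull (liftMap π ι)) (pull (liftPair (liftMap π ι)))
          (bgSourceV (stack G' D') (stack S' SD') (unstackM (gcoefM e η' A') (gacoefM e η' A')))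
          (bgSourceV (stack G D) (stack S SD) (unstackM (gcoefM e η (gavgM 𝔄 J π A')) (gacoefM e η (gavgM 𝔄 J π A')))) :=
      LinearMap.ext fun v => funext fun x' => rfl
    rw [hcomp]
    refine keyj.mono fun a b => ?_
    simp only [one_mul, mul_one]
    exact mul_le_mul_of_nonneg_right h0 (hE a b)
  · -- entry 3: the derived object of `D₃` over the stacked propagator
    have key := hasMaj_idef_bgDerivedV (liftBlk blk ι) (blkPair (liftBlk blk ι)) (liftMap π ι) (liftPair (liftMap π ι)) htri hd hσ hcr hrow (ρ := δ - σ)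
      (by linarith) (by linarith) hβ hR0 hRθ0 (mul_nonneg hm₀ hθ) (mul_nonneg hm₀ hθ) hSG hSG' hD₃' hSDG hDD₃ hV hV' hDV hq1
    refine key.mono fun a b => ?_
    simp only [one_mul]
    refine mul_le_mul_of_nonneg_right ?_ (hE a b)
    have hgc : 0 ≤ gMc35 J (basisConst e) c35 := (le_gMc35 (J := J) hκ hc35).2.le
    have hgca : 0 ≤ gMc35 J (basisConst e) c35 * a₀ := mul_nonneg hgc ha₀
    have h2 : m₀ * θ * cr * (R * (β * u)) ≤ m₀ * θ * cr * (gMc35 J (basisConst e) c35 * a₀ * (β * 2)) := by gcongr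
    have h3 : β * R * cr * ((m₀ * θ * cr + m₀ * θ * cr * (R * (β * u)) + β * (R * θ) * (β * u) * cr) * u) ≤
        1 / 2 * (bgConst β cr m₀ (gMc35 J (basisConst e) c35) a₀ * θ) := mul_le_mul hq' h0 (by positivity) (by norm_num)
    have h4 : β * (R * θ) * (β * u) * cr ≤ β * (gMc35 J (basisConst e) c35 * a₀ * θ) * (β * 2) * cr := by gcongr
    calc m₀ * θ * cr + m₀ * θ * cr * (R * (β * u)) +
          β * R * cr * ((m₀ * θ * cr + m₀ * θ * cr * (R * (β * u)) + β * (R * θ) * (β * u) * cr) * u) + β * (R * θ) * (β * u) * cr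
        ≤ m₀ * θ * cr + m₀ * θ * cr * (gMc35 J (basisConst e) c35 * a₀ * (β * 2)) +
          1 / 2 * (bgConst β cr m₀ (gMc35 J (basisConst e) c35) a₀ * θ) +
          β * (gMc35 J (basisConst e) c35 * a₀ * θ) * (β * 2) * cr := add_le_add (add_le_add (add_le_add le_rfl h2) h3) h4
      _ = bgConst1 β cr m₀ (gMc35 J (basisConst e) c35) a₀ * θ := by unfold bgConst1; ring

end Guard

/-! ## §2 The kernel family, `EtaRateIneq342` per index, `NE2PlusOperator` BY NAME with the non-abelian gauge field live -/

section Readout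

variable {X X' J ι : Type} [Fintype X] [Fintype X'] [Fintype J] [Fintype ι] [DecidableEq X] [DecidableEq X'] [DecidableEq J] [DecidableEq ι]
  {𝔄 : Type} [NormedRing 𝔄] [NormedAlgebra ℝ 𝔄] [CompleteSpace 𝔄] (e : 𝔄 ≃L[ℝ] (ι → ℝ)) {g : B6.Geometry} (blk : X → g.Site) (π : X' → X)

/-- THE FOUR ENTRY OPERATORS at an `𝔄`-valued gauge field `A′` (fine spacing `η′`, coarse spacing `η`): all CONSTRUCTED from the `U ≡ 1` pieces on the product
carrier and the DERIVED matrix coefficients (the non-abelian pair `bgPairM`, the source step, the derived object).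
[cite: Balaban1985BackgroundPropagators, (3.42) p.397 (the four entries: shape); (3.50) p.400 (covariant derivative with `exp(iη ad_{A(b)})`: shape)] -/
def gaugeOpsM4 (η η' : ℝ) (ν : J) (G S D₃ : (X × ι → ℝ) →ₗ[ℝ] (X × ι → ℝ)) (D SD : J → (X × ι → ℝ) →ₗ[ℝ] (X × ι → ℝ))
    (G' S' D₃' : (X' × ι → ℝ) →ₗ[ℝ] (X' × ι → ℝ)) (D' SD' : J → (X' × ι → ℝ) →ₗ[ℝ] (X' × ι → ℝ)) :
    Fin 4 → (J → X' → 𝔄) → ((X × ι → ℝ) →ₗ[ℝ] (X' × ι → ℝ)) :=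
  fun n A' => ![idef (pull (liftMap π ι)) (pull (liftMap π ι)) (projO none ∘ₗ bgPairM G' D' (gcoefM e η' A') (gacoefM e η' A'))
      (projO none ∘ₗ bgPairM G D (gcoefM e η (gavgM 𝔄 J π A')) (gacoefM e η (gavgM 𝔄 J π A'))),
    idef (pull (liftMap π ι)) (pull (liftMap π ι)) (projO (some ν) ∘ₗ bgPairM G' D' (gcoefM e η' A') (gacoefM e η' A'))
      (projO (some ν) ∘ₗ bgPairM G D (gcoefM e η (gavgM 𝔄 J π A')) (gacoefM e η (gavgM 𝔄 J π A'))),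
    idef (pull (liftMap π ι)) (pull (liftMap π ι))
      (projO none ∘ₗ bgSourceV (stack G' D') (stack S' SD') (unstackM (gcoefM e η' A') (gacoefM e η' A')))
      (projO none ∘ₗ bgSourceV (stack G D) (stack S SD) (unstackM (gcoefM e η (gavgM 𝔄 J π A')) (gacoefM e η (gavgM 𝔄 J π A')))),
    idef (pull (liftMap π ι)) (pull (liftMap π ι)) (bgDerivedV (stack G' D') D₃' (unstackM (gcoefM e η' A') (gacoefM e η' A')))
      (bgDerivedV (stack G D) D₃ (unstackM (gcoefM e η (gavgM 𝔄 J π A')) (gacoefM e η (gavgM 𝔄 J π A'))))] n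

/-- THE KERNEL FAMILY over the `𝔄`-valued gauge-field carrier (g0 `opFamily` on the product carrier), spacings `η = g.eta`, `η′ = η·(L^n)⁻¹`.
[cite: Balaban1985BackgroundPropagators, (3.42) p.397 (shape)] -/
def gaugeFamilyM4 (n : ℕ) (hL : g.L ≠ 0) (θc θ : ℝ) (ν : J) (G S D₃ : (X × ι → ℝ) →ₗ[ℝ] (X × ι → ℝ)) (D SD : J → (X × ι → ℝ) →ₗ[ℝ] (X × ι → ℝ))
    (G' S' D₃' : (X' × ι → ℝ) →ₗ[ℝ] (X' × ι → ℝ)) (D' SD' : J → (X' × ι → ℝ) →ₗ[ℝ] (X' × ι → ℝ)) :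
    B9.KernelFamily (gaugeInstanceM 𝔄 J ι blk π n hL θc θ).gc (gaugeInstanceM 𝔄 J ι blk π n hL θc θ).Bf :=
  show B9.KernelFamily (opGeo g (X × ι) (liftBlk blk ι)) (gaugeBgM 𝔄 J π g.M θ) from
    opFamily (g := g) (B := gaugeBgM 𝔄 J π g.M θ) (liftBlk blk ι) (liftBlk (blk ∘ π) ι)
      (gaugeOpsM4 e π g.eta (g.eta * (g.L ^ n)⁻¹) ν G S D₃ D SD G' S' D₃' D' SD')

variable {G S D₃ : (X × ι → ℝ) →ₗ[ℝ] (X × ι → ℝ)} {D SD : J → (X × ι → ℝ) →ₗ[ℝ] (X × ι → ℝ)} {G' S' D₃' : (X' × ι → ℝ) →ₗ[ℝ] (X' × ι → ℝ)}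
  {D' SD' : J → (X' × ι → ℝ) →ₗ[ℝ] (X' × ι → ℝ)}

/-- **`EtaRateIneq342` PER INDEX, NON-ABELIAN GAUGE FIELD LIVE, EXPLICIT CONSTANTS** (`B₀ = bgConst + bgConst1` at `gMc35`, `δ₀ = δ − σ`), for every
`Reg335`-regular `A′ : J → X′ → 𝔄` under the guard. [cite: Balaban1985BackgroundPropagators, Thm 3.1 (3.42) p.397 (shape, quantifier template)] -/
theorem etaRateIneq342_gaugeM (htri : Triangle254 g) (hd : ∀ a b : g.Site, 0 ≤ g.dist a b) {σ cr : ℝ} (hσ : 0 ≤ σ) (hcr : 0 ≤ cr) (hrow : RowSum g σ cr)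
    (hη : 0 < g.eta) (hL : 0 < g.L) (hlen : ∀ y, 1 ≤ g.len y) {δ β m₀ θ c35 a₀ M α₀ γ η' : ℝ}
    (hσδ : σ ≤ δ) (hβ : 0 ≤ β) (hm₀ : 0 ≤ m₀) (hθ : 0 ≤ θ) (hθγ : ∀ y, θ ≤ rateWeight g γ y) (hc35 : 0 < c35) (ha₀ : 0 ≤ a₀)
    (ha₀1 : 2 * (c35 * a₀) ≤ 1) (hq : β * (gMc35 J (basisConst e) c35 * a₀) * cr ≤ 1 / 2) (hM : 1 ≤ M) (hα₀ : 0 < α₀) (hMα : M * α₀ ≤ a₀)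
    (hη' : 0 ≤ η') (hη'η : η' ≤ g.eta) (hη1 : g.eta ≤ 1) (hηθ : g.eta ≤ θ) {ν : J}
    (hG : HasMaj (BlockNorm.ofBlocks g (liftBlk blk ι)) (BlockNorm.ofBlocks g (liftBlk blk ι)) G (fun y y' => β * Real.exp (-(δ * g.dist y y'))))
    (hD : ∀ μ, HasMaj (BlockNorm.ofBlocks g (liftBlk blk ι)) (BlockNorm.ofBlocks g (liftBlk blk ι)) (D μ) (fun y y' => β * Real.exp (-(δ * g.dist y y'))))
    (hG' : HasMaj (BlockNorm.ofBlocks g (liftBlk (blk ∘ π) ι)) (BlockNorm.ofBlocks g (liftBlk (blk ∘ π) ι)) G' (fun y y' => β * Real.exp (-(δ * g.dist y y'))))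
    (hD' : ∀ μ, HasMaj (BlockNorm.ofBlocks g (liftBlk (blk ∘ π) ι)) (BlockNorm.ofBlocks g (liftBlk (blk ∘ π) ι)) (D' μ) (fun y y' => β * Real.exp (-(δ * g.dist y y'))))
    (hS : HasMaj (BlockNorm.ofBlocks g (liftBlk blk ι)) (BlockNorm.ofBlocks g (liftBlk blk ι)) S (fun y y' => β * Real.exp (-(δ * g.dist y y'))))
    (hSD : ∀ μ, HasMaj (BlockNorm.ofBlocks g (liftBlk blk ι)) (BlockNorm.ofBlocks g (liftBlk blk ι)) (SD μ) (fun y y' => β * Real.exp (-(δ * g.dist y y'))))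
    (hD₃' : HasMaj (BlockNorm.ofBlocks g (liftBlk (blk ∘ π) ι)) (BlockNorm.ofBlocks g (liftBlk (blk ∘ π) ι)) D₃' (fun y y' => β * Real.exp (-(δ * g.dist y y'))))
    (hDG : HasMaj (BlockNorm.ofBlocks g (liftBlk blk ι)) (BlockNorm.ofBlocks g (liftBlk (blk ∘ π) ι))
      (idef (pull (liftMap π ι)) (pull (liftMap π ι)) G' G) (fun y y' => m₀ * θ * Real.exp (-(δ * g.dist y y'))))
    (hDD : ∀ μ, HasMaj (BlockNorm.ofBlocks g (liftBlk blk ι)) (BlockNorm.ofBlocks g (liftBlk (blk ∘ π) ι))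
      (idef (pull (liftMap π ι)) (pull (liftMap π ι)) (D' μ) (D μ)) (fun y y' => m₀ * θ * Real.exp (-(δ * g.dist y y'))))
    (hDS : HasMaj (BlockNorm.ofBlocks g (liftBlk blk ι)) (BlockNorm.ofBlocks g (liftBlk (blk ∘ π) ι))
      (idef (pull (liftMap π ι)) (pull (liftMap π ι)) S' S) (fun y y' => m₀ * θ * Real.exp (-(δ * g.dist y y'))))
    (hDSD : ∀ μ, HasMaj (BlockNorm.ofBlocks g (liftBlk blk ι)) (BlockNorm.ofBlocks g (liftBlk (blk ∘ π) ι))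
      (idef (pull (liftMap π ι)) (pull (liftMap π ι)) (SD' μ) (SD μ)) (fun y y' => m₀ * θ * Real.exp (-(δ * g.dist y y'))))
    (hDD₃ : HasMaj (BlockNorm.ofBlocks g (liftBlk blk ι)) (BlockNorm.ofBlocks g (liftBlk (blk ∘ π) ι))
      (idef (pull (liftMap π ι)) (pull (liftMap π ι)) D₃' D₃) (fun y y' => m₀ * θ * Real.exp (-(δ * g.dist y y'))))
    {A' : J → X' → 𝔄} (hreg : (gaugeBgM 𝔄 J π M θ).Reg335 c35 α₀ A') :
    EtaRateIneq342 (opFamily (g := g) (B := gaugeBgM 𝔄 J π M θ) (liftBlk blk ι) (liftBlk (blk ∘ π) ι)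
        (gaugeOpsM4 e π g.eta η' ν G S D₃ D SD G' S' D₃' D' SD'))
      (bgConst β cr m₀ (gMc35 J (basisConst e) c35) a₀ + bgConst1 β cr m₀ (gMc35 J (basisConst e) c35) a₀) (δ - σ) γ A' := by
  obtain ⟨h01, h2, h3⟩ := hasMaj_gaugeM_entries e blk π htri hd hσ hcr hrow hσδ hβ hm₀ hθ hc35 ha₀ ha₀1 hq hM hα₀ hMα hη' hη'η hη1 hηθ hG hD hG' hD' hS
    hSD hD₃' hDG hDD hDS hDSD hDD₃ hreg
  have hgc : 0 ≤ gMc35 J (basisConst e) c35 := (le_gMc35 (J := J) (basisConst_nonneg e) hc35).2.le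
  have hC0 : 0 ≤ bgConst β cr m₀ (gMc35 J (basisConst e) c35) a₀ := bgConst_nonneg hβ hcr hm₀ hgc ha₀
  have hC1 : 0 ≤ bgConst1 β cr m₀ (gMc35 J (basisConst e) c35) a₀ := bgConst1_nonneg hβ hcr hm₀ hgc ha₀
  set B₀ : ℝ := bgConst β cr m₀ (gMc35 J (basisConst e) c35) a₀ + bgConst1 β cr m₀ (gMc35 J (basisConst e) c35) a₀ with hB₀_def
  have hB₀ : 0 ≤ B₀ := add_nonneg hC0 hC1
  refine etaRateIneq342_of_hasMaj (g := g) (B := gaugeBgM 𝔄 J π M θ) (liftBlk blk ι) (liftBlk (blk ∘ π) ι) hη.le hL.le hB₀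
    (gaugeOpsM4 e π g.eta η' ν G S D₃ D SD G' S' D₃' D' SD') A' fun n => ?_
  have hdom : ∀ {B : ℝ}, 0 ≤ B → B ≤ B₀ → ∀ y y' : g.Site,
      B * θ * Real.exp (-((δ - σ) * g.dist y y')) ≤
        B₀ * B9.pref4 ((opGeo g (X × ι) (liftBlk blk ι)).len y) n * Real.exp (-((δ - σ) * g.dist y y')) *
          max (rateFactor (opGeo g (X × ι) (liftBlk blk ι)) γ y) (rateFactor (opGeo g (X × ι) (liftBlk blk ι)) γ y') := by
    intro B hB0 hB y y'
    have hpref : 1 ≤ B9.pref4 ((opGeo g (X × ι) (liftBlk blk ι)).len y) n := by rw [opGeo_len]; exact one_le_pref4 (hlen y) n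
    have hrf : θ ≤ max (rateFactor (opGeo g (X × ι) (liftBlk blk ι)) γ y) (rateFactor (opGeo g (X × ι) (liftBlk blk ι)) γ y') := by
      rw [rateFactor_opGeo g (X × ι) (liftBlk blk ι) hη.ne' hL γ y']
      exact (hθγ y').trans (le_max_right _ _)
    have hE : 0 ≤ Real.exp (-((δ - σ) * g.dist y y')) := Real.exp_nonneg _
    calc B * θ * Real.exp (-((δ - σ) * g.dist y y'))
        ≤ (B₀ * B9.pref4 ((opGeo g (X × ι) (liftBlk blk ι)).len y) n) * θ * Real.exp (-((δ - σ) * g.dist y y')) := by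
          refine mul_le_mul_of_nonneg_right (mul_le_mul_of_nonneg_right ?_ hθ) hE
          calc B = B * 1 := (mul_one B).symm
            _ ≤ _ := mul_le_mul hB hpref zero_le_one hB₀
      _ = B₀ * B9.pref4 ((opGeo g (X × ι) (liftBlk blk ι)).len y) n * Real.exp (-((δ - σ) * g.dist y y')) * θ := by ring
      _ ≤ _ := mul_le_mul_of_nonneg_left hrf (mul_nonneg (mul_nonneg hB₀ (zero_le_one.trans hpref)) hE)
  fin_cases n
  · exact (h01 none).mono (hdom hC0 (le_add_of_nonneg_right hC1))
  · exact (h01 (some ν)).mono (hdom hC0 (le_add_of_nonneg_right hC1))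
  · exact h2.mono (hdom hC0 (le_add_of_nonneg_right hC1))
  · exact h3.mono (hdom hC1 (le_add_of_nonneg_left hC0))

end Readout

section Node

variable {I J ι : Type} [Fintype J] [DecidableEq J] [Fintype ι] [DecidableEq ι] {𝔄 : Type} [NormedRing 𝔄] [NormedAlgebra ℝ 𝔄] [CompleteSpace 𝔄]
  (e : 𝔄 ≃L[ℝ] (ι → ℝ)) (g : I → B6.Geometry) (X X' : I → Type) [∀ i, Fintype (X i)] [∀ i, Fintype (X' i)] [∀ i, DecidableEq (X i)]
  [∀ i, DecidableEq (X' i)] (blk : ∀ i, X i → (g i).Site) (π : ∀ i, X' i → X i) (nsh : I → ℕ) (hL0 : ∀ i, (g i).L ≠ 0) (θc θ : I → ℝ) (ν : I → J)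
  (G S D₃ : ∀ i, (X i × ι → ℝ) →ₗ[ℝ] (X i × ι → ℝ)) (D SD : ∀ i, J → (X i × ι → ℝ) →ₗ[ℝ] (X i × ι → ℝ))
  (G' S' D₃' : ∀ i, (X' i × ι → ℝ) →ₗ[ℝ] (X' i × ι → ℝ)) (D' SD' : ∀ i, J → (X' i × ι → ℝ) →ₗ[ℝ] (X' i × ι → ℝ))

/-- **NE2⁺, OPERATOR LAYER — `T4EtaRate.NE2PlusOperator` BY NAME WITH THE NON-ABELIAN GAUGE FIELD LIVE, ALL FOUR ENTRIES CONSTRUCTED, ONLY THE `U ≡ 1` LAYER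
DISPLAYED.**  For ANY family — [B6] carriers with (2.54), `d ≥ 0`, uniform (2.61) `(σ, c_r)`, `0 < η ≤ min(1, θ_i)`, `L ≥ 1`, sites of size `≥ 1`; a fixed direction
set `J`; `𝔤` modelled by `𝔄 ≅ ℝ^ι` with coordinates `e`; the `U ≡ 1` LAYER ON THE PRODUCT CARRIERS with UNIFORM letters (majorants `β·e^{−δd}`, `σ < δ`, of
`G, ∇_μG, G∇*, ∇_μG∇*` coarse and `G′, ∇′_μG′, Δ′G′` fine; η-defects `m₀·θ_i·e^{−δd}` of the five pairs; `θ_i ≤ (L^j)^{−γ}`, `γ > 0`); `c₃₅ > 0` —: the realised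
instances over the `𝔄`-VALUED GAUGE-FIELD carriers (configurations `A′ : J → X′ → 𝔄`, `Reg335` = the (3.35) letter pair in the norm of `𝔄`, transport = fibrewise
mean, guard = the datum's `M`) with the kernel families `gaugeFamilyM4` (perturbation's MATRIX coefficients DERIVED from `A′` by `Phi1(η, ad_A)` in coordinates)
satisfy `NE2PlusOperator c₃₅`, with `M₅ = 1`, `a₀ = (2·gMc35·(βc_r + 1))⁻¹`, `B₀ = bgConst + bgConst1 + 1`, `δ₀ = δ − σ`; (3.35) is CONSUMED on the non-abelian
gauge field itself. [cite: Balaban1985BackgroundPropagators, Thm 3.1 p.397 (quantifier template); (3.35) p.396, (3.42) + (3.44) p.397, (3.50)–(3.52) p.400, (3.63)–(3.65) pp.402–403 (shapes, mechanism)] -/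
theorem ne2PlusOperator_gaugeM (c35 : ℝ) (hc35 : 0 < c35)
    (htri : ∀ i, Triangle254 (g i)) (hd : ∀ i (a b : (g i).Site), 0 ≤ (g i).dist a b) {σ cr : ℝ} (hσ : 0 ≤ σ) (hcr : 0 ≤ cr)
    (hrow : ∀ i, RowSum (g i) σ cr) (hη : ∀ i, 0 < (g i).eta) (hη1 : ∀ i, (g i).eta ≤ 1) (hηθ : ∀ i, (g i).eta ≤ θ i) (hL : ∀ i, 1 ≤ (g i).L)
    (hlen : ∀ i y, 1 ≤ (g i).len y) {δ β m₀ γ : ℝ} (hσδ : σ < δ) (hβ : 0 ≤ β) (hm₀ : 0 ≤ m₀) (hγ : 0 < γ) (hθγ : ∀ i y, θ i ≤ rateWeight (g i) γ y)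
    (hG : ∀ i, HasMaj (BlockNorm.ofBlocks (g i) (liftBlk (blk i) ι)) (BlockNorm.ofBlocks (g i) (liftBlk (blk i) ι)) (G i)
      (fun y y' => β * Real.exp (-(δ * (g i).dist y y'))))
    (hD : ∀ i μ, HasMaj (BlockNorm.ofBlocks (g i) (liftBlk (blk i) ι)) (BlockNorm.ofBlocks (g i) (liftBlk (blk i) ι)) (D i μ)
      (fun y y' => β * Real.exp (-(δ * (g i).dist y y'))))
    (hG' : ∀ i, HasMaj (BlockNorm.ofBlocks (g i) (liftBlk (blk i ∘ π i) ι)) (BlockNorm.ofBlocks (g i) (liftBlk (blk i ∘ π i) ι)) (G' i)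
      (fun y y' => β * Real.exp (-(δ * (g i).dist y y'))))
    (hD' : ∀ i μ, HasMaj (BlockNorm.ofBlocks (g i) (liftBlk (blk i ∘ π i) ι)) (BlockNorm.ofBlocks (g i) (liftBlk (blk i ∘ π i) ι)) (D' i μ)
      (fun y y' => β * Real.exp (-(δ * (g i).dist y y'))))
    (hS : ∀ i, HasMaj (BlockNorm.ofBlocks (g i) (liftBlk (blk i) ι)) (BlockNorm.ofBlocks (g i) (liftBlk (blk i) ι)) (S i)
      (fun y y' => β * Real.exp (-(δ * (g i).dist y y'))))
    (hSD : ∀ i μ, HasMaj (BlockNorm.ofBlocks (g i) (liftBlk (blk i) ι)) (BlockNorm.ofBlocks (g i) (liftBlk (blk i) ι)) (SD i μ)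
      (fun y y' => β * Real.exp (-(δ * (g i).dist y y'))))
    (hD₃' : ∀ i, HasMaj (BlockNorm.ofBlocks (g i) (liftBlk (blk i ∘ π i) ι)) (BlockNorm.ofBlocks (g i) (liftBlk (blk i ∘ π i) ι)) (D₃' i)
      (fun y y' => β * Real.exp (-(δ * (g i).dist y y'))))
    (hDG : ∀ i, HasMaj (BlockNorm.ofBlocks (g i) (liftBlk (blk i) ι)) (BlockNorm.ofBlocks (g i) (liftBlk (blk i ∘ π i) ι))
      (idef (pull (liftMap (π i) ι)) (pull (liftMap (π i) ι)) (G' i) (G i)) (fun y y' => m₀ * θ i * Real.exp (-(δ * (g i).dist y y'))))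
    (hDD : ∀ i μ, HasMaj (BlockNorm.ofBlocks (g i) (liftBlk (blk i) ι)) (BlockNorm.ofBlocks (g i) (liftBlk (blk i ∘ π i) ι))
      (idef (pull (liftMap (π i) ι)) (pull (liftMap (π i) ι)) (D' i μ) (D i μ)) (fun y y' => m₀ * θ i * Real.exp (-(δ * (g i).dist y y'))))
    (hDS : ∀ i, HasMaj (BlockNorm.ofBlocks (g i) (liftBlk (blk i) ι)) (BlockNorm.ofBlocks (g i) (liftBlk (blk i ∘ π i) ι))
      (idef (pull (liftMap (π i) ι)) (pull (liftMap (π i) ι)) (S' i) (S i)) (fun y y' => m₀ * θ i * Real.exp (-(δ * (g i).dist y y'))))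
    (hDSD : ∀ i μ, HasMaj (BlockNorm.ofBlocks (g i) (liftBlk (blk i) ι)) (BlockNorm.ofBlocks (g i) (liftBlk (blk i ∘ π i) ι))
      (idef (pull (liftMap (π i) ι)) (pull (liftMap (π i) ι)) (SD' i μ) (SD i μ)) (fun y y' => m₀ * θ i * Real.exp (-(δ * (g i).dist y y'))))
    (hDD₃ : ∀ i, HasMaj (BlockNorm.ofBlocks (g i) (liftBlk (blk i) ι)) (BlockNorm.ofBlocks (g i) (liftBlk (blk i ∘ π i) ι))
      (idef (pull (liftMap (π i) ι)) (pull (liftMap (π i) ι)) (D₃' i) (D₃ i)) (fun y y' => m₀ * θ i * Real.exp (-(δ * (g i).dist y y')))) :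
    NE2PlusOperator c35 (fun i => gaugeInstanceM 𝔄 J ι (blk i) (π i) (nsh i) (hL0 i) (θc i) (θ i))
      (fun i => gaugeFamilyM4 e (blk i) (π i) (nsh i) (hL0 i) (θc i) (θ i) (ν i) (G i) (S i) (D₃ i) (D i) (SD i) (G' i) (S' i) (D₃' i) (D' i) (SD' i)) := by
  obtain ⟨hcg, hgpos⟩ := le_gMc35 (J := J) (basisConst_nonneg e) hc35
  set a₀ : ℝ := (2 * gMc35 J (basisConst e) c35 * (β * cr + 1))⁻¹ with ha₀_def
  have hden : 0 < 2 * gMc35 J (basisConst e) c35 * (β * cr + 1) := by positivity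
  have ha₀ : 0 < a₀ := inv_pos.2 hden
  have hq : β * (gMc35 J (basisConst e) c35 * a₀) * cr ≤ 1 / 2 := by
    have h1 : β * (gMc35 J (basisConst e) c35 * a₀) * cr = (β * cr) * (gMc35 J (basisConst e) c35 * a₀) := by ring
    have h2 : gMc35 J (basisConst e) c35 * a₀ = (2 * (β * cr + 1))⁻¹ := by
      rw [ha₀_def]; field_simp
    rw [h1, h2, ← div_eq_mul_inv, div_le_iff₀ (by positivity)]
    nlinarith [mul_nonneg hβ hcr]
  have ha₀1 : 2 * (c35 * a₀) ≤ 1 := by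
    have h2 : 2 * (c35 * a₀) = c35 / (gMc35 J (basisConst e) c35 * (β * cr + 1)) := by
      rw [ha₀_def]; field_simp
    rw [h2, div_le_one (by positivity)]
    nlinarith [mul_nonneg hβ hcr, hgpos]
  have hC0 : 0 ≤ bgConst β cr m₀ (gMc35 J (basisConst e) c35) a₀ := bgConst_nonneg hβ hcr hm₀ hgpos.le ha₀.le
  have hC1 : 0 ≤ bgConst1 β cr m₀ (gMc35 J (basisConst e) c35) a₀ := bgConst1_nonneg hβ hcr hm₀ hgpos.le ha₀.le
  refine ⟨1, δ - σ, a₀, bgConst β cr m₀ (gMc35 J (basisConst e) c35) a₀ + bgConst1 β cr m₀ (gMc35 J (basisConst e) c35) a₀ + 1, γ, one_pos, by linarith,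
    ha₀, by linarith, hγ, fun i hM α₀ hα₀ hMα A' hreg => ?_⟩
  have hM' : 1 ≤ (g i).M := hM
  have hMα' : (g i).M * α₀ ≤ a₀ := hMα
  have hLpos : 0 < (g i).L := lt_of_lt_of_le one_pos (hL i)
  have hη'0 : 0 ≤ (g i).eta * ((g i).L ^ nsh i)⁻¹ := mul_nonneg (hη i).le (inv_nonneg.2 (pow_nonneg hLpos.le _))
  have hη'η : (g i).eta * ((g i).L ^ nsh i)⁻¹ ≤ (g i).eta := by
    have h1 : ((g i).L ^ nsh i)⁻¹ ≤ 1 := inv_le_one_of_one_le₀ (one_le_pow₀ (hL i))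
    calc (g i).eta * ((g i).L ^ nsh i)⁻¹ ≤ (g i).eta * 1 := mul_le_mul_of_nonneg_left h1 (hη i).le
      _ = (g i).eta := mul_one _
  have hθ0 : 0 ≤ θ i := (hη i).le.trans (hηθ i)
  have key := etaRateIneq342_gaugeM e (J := J) (blk i) (π i) (htri i) (hd i) hσ hcr (hrow i) (hη i) hLpos (hlen i) hσδ.le hβ hm₀ hθ0 (hθγ i) hc35
    ha₀.le ha₀1 hq hM' hα₀ hMα' hη'0 hη'η (hη1 i) (hηθ i) (ν := ν i) (hG i) (hD i) (hG' i) (hD' i) (hS i) (hSD i) (hD₃' i) (hDG i) (hDD i) (hDS i)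
    (hDSD i) (hDD₃ i) hreg
  intro n lam y y' hs
  refine (key n lam y y' hs).trans ?_
  have hpref : 0 ≤ B9.pref4 ((gaugeInstanceM 𝔄 J ι (blk i) (π i) (nsh i) (hL0 i) (θc i) (θ i)).gc.len y) n := by
    have : 1 ≤ B9.pref4 ((opGeo (g i) (X i × ι) (liftBlk (blk i) ι)).len y) n := by rw [opGeo_len]; exact one_le_pref4 (hlen i y) n
    exact zero_le_one.trans this
  have hrf : 0 ≤ max (rateFactor (gaugeInstanceM 𝔄 J ι (blk i) (π i) (nsh i) (hL0 i) (θc i) (θ i)).gc γ y)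
      (rateFactor (gaugeInstanceM 𝔄 J ι (blk i) (π i) (nsh i) (hL0 i) (θc i) (θ i)).gc γ y') :=
    (T4EtaRate.rateFactor_nonneg (g := opGeo (g i) (X i × ι) (liftBlk (blk i) ι)) (hη i).le hLpos.le γ y).trans (le_max_left _ _)
  have hnorm : 0 ≤ (gaugeInstanceM 𝔄 J ι (blk i) (π i) (nsh i) (hL0 i) (θc i) (θ i)).gc.supNorm lam := Real.iSup_nonneg fun x => abs_nonneg _
  have hE : 0 ≤ Real.exp (-((δ - σ) * (gaugeInstanceM 𝔄 J ι (blk i) (π i) (nsh i) (hL0 i) (θc i) (θ i)).gc.dist y y')) := Real.exp_nonneg _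
  exact mul_le_mul_of_nonneg_right (mul_le_mul_of_nonneg_right (mul_le_mul_of_nonneg_right
    (mul_le_mul_of_nonneg_right (le_add_of_nonneg_right zero_le_one) hpref) hE) hrf) hnorm

end Node

end Summit.QuantumFields.YangMills.BalabanUVNodes.N15.BackgroundLayer
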